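import Summits.SmoothPoincare4.SmoothPoincare4.Theses.CylinderEntropy
import Summits.SmoothPoincare4.SmoothPoincare4.Theorems.CylinderEntropyCylinderRungTwoSurgeryDefs
import Summits.SmoothPoincare4.SmoothPoincare4.Theorems.CylinderEntropyCylinderRungTwoImmortalLeafRecognition
import Literature.Geometry.Riemannian.LowEntropyHypersurfacesFourNeckSurgery
import Literature.Topology.FourManifolds.HomotopyS4CompactProofs
import Literature.Topology.FourManifolds.HomotopyS4SimplyConnected
import Literature.Topology.FourManifolds.SphereSimplyConnected
import HarnessLib

/-!
# Route `CylinderEntropy`, crux `CylinderRungTwo` (stmt-SmoothPoincare4-7631), line `killing-flux`, reshape r15: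
# THE TOPOLOGY OF THE SURGERY TREE and the REDUCTION of the crux to the surgery path

Since lead reshape r15 the finite-time half of the crux is the registered stub `stub_cylinderSurgeryFlow`: for a homotopy
4-sphere `M` with a thin end-separating cross-section embedding into `N = S⁴ × ℝ`, SOME slice `κ : M → ℝ⁶` is resolved by a mean
curvature flow with neck surgery in `N` (`CylNeckSurgeryResolvable M κ`, vocabulary file `…CylinderRungTwoSurgeryDefs.lean`: finitely
many smooth flows between stopping times, necks replaced by standard caps, components discarded when `≅ S⁴` or `S³ × S¹`, the
survivors flowing smoothly forever as thin end-separating cross-sections — the `immortal` leaves).  This file PROVES: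

* `helper_cylNeckSurgeryTopology` — **the topology of the surgery tree**: a SIMPLY CONNECTED smooth closed `4`-manifold, a slice of
  which is so resolved, is diffeomorphic to `S⁴`, PROVIDED immortal leaves are recognised (hypothesis: every compact connected simply
  connected carrier of an immortal thin separating `IsCylinderMCF` is `≅ S⁴` — discharged by `helper_immortalLeafRecognition` from the
  immortal half and Cor. 1.5 (b)).  Daniels-Holgate's backward induction exactly as in the tree's Euclidean
  `MCFNeckSurgeryResolvable.isNeckSurgeryResolvable` (`LowEntropyHypersurfacesFourNeckSurgery.lean`): discarded components are model
  pieces, flows and reparametrisations do not change the manifold, a cut along a separating neck is the `surgery` constructor of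
  `IsNeckSurgeryResolvable` with simply connected capped sides (`NeckCapData.isConnectedSum_capped`,
  `IsConnectedSum.simplyConnectedSpace_left/right`), a simply connected slice has no non-separating neck
  (`not_isPreconnected_compl_image_neck`), an immortal leaf is a sphere by the hypothesis; then
  `IsNeckSurgeryResolvable.nonempty_diffeomorph_sphere` (Kervaire–Milnor `S⁴ # S⁴ ≅ S⁴`).
* `helper_cylinderRungTwoOfSurgery` — **the crux from the surgery path**: `stub_cylinderSurgeryFlow` → `stub_areaToFloor` (the
  immortal half, = route crux ImmortalAreaToFloor stmt-17197) → Cor. 1.5 (b) → mid-scale certificates → `CylinderRungTwo`, all four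
  stated verbatim as hypotheses (the route decl unfolds by `rfl`).
* `helper_cylinderSurgeryFlowOfCylinderRungTwo` — **the converse**: the crux implies `stub_cylinderSurgeryFlow` outright (the
  `discard` leaf on `M ≅ S⁴`), so the new stub is crux-equivalent modulo {ImmortalAreaToFloor, Cor. 1.5 (b), certificates} — the
  kernel-checked form of "the finite-time half is where the crux-hardness lives" (cf. the standing disprover's sandwich).

No `sorry`, no definition, no new named fact; the theorems are conditional exactly on their displayed hypotheses.

References: J. M. Daniels-Holgate, Adv. Math. 410 (2022), Thm. 1.3, Lemma 6.2, proof of Thm. 6.4; O. Chodosh, C. Mantoulidis,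
F. Schulze, Duke Math. J. 174 (2025), Cor. 1.5 (b); M. Kervaire, J. Milnor, Ann. of Math. 77 (1963), Lemma 2.1; R. S. Hamilton,
Comm. Anal. Geom. 5 (1997), §1.1.
-/

noncomputable section

-- the registered namespace repeats a component
set_option linter.dupNamespace false

open MeasureTheory Set Function
open scoped Manifold ContDiff ENNReal Topology BigOperators ContinuousMap

namespace Summit.SmoothPoincare4.SmoothPoincare4.Cruxes.CylinderRungTwo.KillingFlux

open Literature.Geometry.Riemannian
open Literature.Geometry.Riemannian.SphericalCylinderEntropy (cylEntropy)
open Literature.Topology.FourManifolds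
open Summit.SmoothPoincare4.SmoothPoincare4.Theses.CylinderEntropy (CylinderRungTwo)

/-- **The topology of the surgery tree, inductive step** (Daniels-Holgate's backward induction in `N`): a SIMPLY CONNECTED slice
resolved by a mean curvature flow with neck surgery in `N` is neck-surgery resolvable in Hamilton's sense, provided every compact
connected simply connected carrier of an immortal thin separating flow is `≅ S⁴` (hypothesis `hrec`).
[cite: DanielsHolgate2022, Lemma 6.2 and proof of Thm. 6.4] [cite: Hamilton1997, §1.1 pp. 3–4] -/
theorem CylNeckSurgeryResolvable.isNeckSurgeryResolvable_of
    (hrec : ∀ (P : Type) [TopologicalSpace P] [T2Space P] [SecondCountableTopology P]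
      [ChartedSpace (EuclideanSpace ℝ (Fin 4)) P] [IsManifold (𝓡 4) ∞ P] [CompactSpace P] [ConnectedSpace P],
      SimplyConnectedSpace P →
      ∀ (F : ℝ → P → EuclideanSpace ℝ (Fin 6)) (ν : ℝ → P → EuclideanSpace ℝ (Fin 6)) (T : ℝ),
      IsCylinderMCF P F ν T →
      (∀ t, T ≤ t → SeparatesEnds (Set.range (F t))) →
      (∀ t, T ≤ t → cylEntropy (Set.range (F t)) < 2) →
      Nonempty (P ≃ₘ⟮𝓡 4, 𝓡 4⟯ Metric.sphere (0 : EuclideanSpace ℝ (Fin 5)) 1))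
    {M : Type} [TopologicalSpace M] [ChartedSpace (EuclideanSpace ℝ (Fin 4)) M] {κ : M → EuclideanSpace ℝ (Fin 6)}
    (h : CylNeckSurgeryResolvable M κ) (hsc : SimplyConnectedSpace M) : IsNeckSurgeryResolvable M := by
  haveI : Fact (Module.finrank ℝ (EuclideanSpace ℝ (Fin 4)) = 3 + 1) := ⟨finrank_euclideanSpace_fin⟩
  induction h with
  | discard hM κ => exact .piece hM.isHamiltonPICPiece
  | flow hT hF h ih => exact ih hsc
  | of_diffeomorph h e ih =>
    exact (ih ((e.toHomeomorph.toHomotopyEquiv.simplyConnectedSpace_iff).2 hsc)).of_diffeomorph e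
  | cut κ D₁ D₂ hdisj hcover κ₁ κ₂ h₁ h₂ ih₁ ih₂ =>
    haveI := hsc
    have hcs := D₁.isConnectedSum_capped D₂ (fun _ _ => rfl) hdisj hcover
    have h2 : 1 < Module.finrank ℝ (EuclideanSpace ℝ (Fin 4)) := by
      rw [finrank_euclideanSpace_fin]
      norm_num
    exact .surgery D₁ D₂ hdisj hcover (ih₁ (hcs.simplyConnectedSpace_left h2))
      (ih₂ (hcs.simplyConnectedSpace_right h2))
  | cutNonseparating κ hψ hψo hns κ' h ih =>
    rename_i M _ _ _ _ ψ
    haveI := hsc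
    haveI : LocallyPathConnectedSpace M := ChartedSpace.locallyPathConnectedSpace (EuclideanSpace ℝ (Fin 4)) M
    haveI : Nonempty (Metric.sphere (0 : EuclideanSpace ℝ (Fin 4)) 1) := ⟨unitSpherePoint 3⟩
    exact absurd hns (not_isPreconnected_compl_image_neck ⟨hψ.isEmbedding, hψo⟩)
  | immortal hF hsep hthin =>
    rename_i P _ _ _ _ _ _ _ F ν T
    exact .of_nonempty_diffeomorph_sphere (hrec P hsc F ν T hF hsep hthin)

/-- **Registered helper `helper_cylNeckSurgeryTopology` — the topology of the surgery tree.**  Given recognition of immortal leaves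
(first hypothesis, the conclusion of `helper_immortalLeafRecognition`), a simply connected smooth closed `4`-manifold, a slice of
which is resolved by a mean curvature flow with neck surgery in `N` (`CylNeckSurgeryResolvable`), is diffeomorphic to `S⁴`: it is
neck-surgery resolvable (`isNeckSurgeryResolvable_of`), hence a connected sum of copies of `S⁴`, hence `S⁴` (Kervaire–Milnor).
[cite: DanielsHolgate2022, proof of Thm. 6.4] [cite: KervaireMilnor1963, §2, Lemma 2.1] -/
theorem helper_cylNeckSurgeryTopology :
    (∀ (P : Type) [TopologicalSpace P] [T2Space P] [SecondCountableTopology P]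
      [ChartedSpace (EuclideanSpace ℝ (Fin 4)) P] [IsManifold (𝓡 4) ∞ P] [CompactSpace P] [ConnectedSpace P],
      SimplyConnectedSpace P →
      ∀ (F : ℝ → P → EuclideanSpace ℝ (Fin 6)) (ν : ℝ → P → EuclideanSpace ℝ (Fin 6)) (T : ℝ),
      IsCylinderMCF P F ν T →
      (∀ t, T ≤ t → SeparatesEnds (Set.range (F t))) →
      (∀ t, T ≤ t → Literature.Geometry.Riemannian.SphericalCylinderEntropy.cylEntropy (Set.range (F t)) < 2) →
      Nonempty (P ≃ₘ⟮𝓡 4, 𝓡 4⟯ Metric.sphere (0 : EuclideanSpace ℝ (Fin 5)) 1)) →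
    ∀ (M : Type) [TopologicalSpace M] [ChartedSpace (EuclideanSpace ℝ (Fin 4)) M] [IsManifold (𝓡 4) ∞ M]
      (κ : M → EuclideanSpace ℝ (Fin 6)), CylNeckSurgeryResolvable M κ → SimplyConnectedSpace M →
      Nonempty (M ≃ₘ⟮𝓡 4, 𝓡 4⟯ Metric.sphere (0 : EuclideanSpace ℝ (Fin 5)) 1) :=
  fun hrec _M _ _ _ _κ h hsc => (h.isNeckSurgeryResolvable_of hrec hsc).nonempty_diffeomorph_sphere hsc

/-- **Registered helper `helper_cylinderRungTwoOfSurgery` — THE CRUX FROM THE SURGERY PATH** (r15 reduction, kernel-checked):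
`stub_cylinderSurgeryFlow` (first hypothesis, verbatim) → `stub_areaToFloor` (second, verbatim; = route crux ImmortalAreaToFloor,
stmt-SmoothPoincare4-17197) → Chodosh–Mantoulidis–Schulze 2025 Cor. 1.5 (b), `n = 4` (third; Literature named fact) → the mid-scale
kernel certificates (fourth; registered `stub_certMid`, landed computationally) → `CylinderEntropy.CylinderRungTwo`.  Proof: the
homotopy sphere `M` is compact, connected and simply connected (tree); the surgery flow resolves a slice of `M`; immortal leaves are
recognised by `helper_immortalLeafRecognition`; the topology of the surgery tree (`helper_cylNeckSurgeryTopology`) gives `M ≅ S⁴`.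
[cite: DanielsHolgate2022, Thm. 1.3 and proof of Thm. 6.4] [cite: ChodoshMantoulidisSchulze2025, Cor. 1.5 (b)] -/
theorem helper_cylinderRungTwoOfSurgery :
    (∀ (M : Type) [TopologicalSpace M] [T2Space M] [SecondCountableTopology M]
      [ChartedSpace (EuclideanSpace ℝ (Fin 4)) M] [IsManifold (𝓡 4) ∞ M],
      M ≃ₕ Metric.sphere (0 : EuclideanSpace ℝ (Fin 5)) 1 →
      ∀ ι : M → EuclideanSpace ℝ (Fin 6), Manifold.IsSmoothEmbedding (𝓡 4) (𝓡 6) ∞ ι →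
      (∀ x, ∑ i : Fin 5, ι x (Fin.castSucc i) ^ 2 = 1) → SeparatesEnds (Set.range ι) →
      Literature.Geometry.Riemannian.SphericalCylinderEntropy.cylEntropy (Set.range ι) < ENNReal.ofReal (4 / Real.exp 1) →
      ∃ κ : M → EuclideanSpace ℝ (Fin 6), CylNeckSurgeryResolvable M κ) →
    (∀ (M : Type) [TopologicalSpace M] [T2Space M] [SecondCountableTopology M]
      [ChartedSpace (EuclideanSpace ℝ (Fin 4)) M] [IsManifold (𝓡 4) ∞ M] [CompactSpace M]
      [ConnectedSpace M]
      (F : ℝ → M → EuclideanSpace ℝ (Fin 6)) (ν : ℝ → M → EuclideanSpace ℝ (Fin 6)) (T : ℝ),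
      IsCylinderMCF M F ν T →
      (∀ t, T ≤ t → SeparatesEnds (Set.range (F t))) →
      (∀ t, T ≤ t → Literature.Geometry.Riemannian.SphericalCylinderEntropy.cylEntropy (Set.range (F t)) < 2) →
      ∀ ε : ℝ, 0 < ε → ∃ t : ℝ, T ≤ t ∧
        μH[4] (Set.range (F t)) ≤
          ENNReal.ofReal (1 + ε) * μH[4] (Metric.sphere (0 : EuclideanSpace ℝ (Fin 5)) 1)) →
    Literature.Geometry.Riemannian.ChodoshMantoulidisSchulze2025_cor15b_four →
    (∀ T : ℝ, 1 / 100 ≤ T → T ≤ 10 →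
      ∃ (n : ℕ) (σ τ w : Fin n → ℝ) (c : ℝ), (∀ j, 0 < τ j) ∧ (∀ j, 0 ≤ w j) ∧ 0 ≤ c ∧ (∑ j, w j) + c ≤ 147 / 100 ∧
        ∀ u s : ℝ, -1 ≤ s → s ≤ 1 →
          (8 * Real.pi ^ 2 / 3) * ((4 * Real.pi * T) ^ 2)⁻¹ * Real.exp (4 * u) *
              Real.exp (-(Real.exp (2 * u) - 2 * Real.exp u * s + 1) / (4 * T)) ≤
            (∑ j, w j * (Literature.Geometry.Riemannian.SphericalCylinderEntropy.zonal (τ j) s *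
              Real.exp (-(u - σ j) ^ 2 / (4 * τ j)))) + c) →
    Summit.SmoothPoincare4.SmoothPoincare4.Theses.CylinderEntropy.CylinderRungTwo := by
  intro hflow hAF hb hmid M _ _ _ _ _ e ι hι hN hsep hent
  haveI : CompactSpace M :=
    Literature.Topology.FourManifolds.compactSpace_of_homotopyEquiv_sphere_four_holds M e
  haveI : PathConnectedSpace M := by
    haveI := Literature.Topology.FourManifolds.pathConnectedSpace_sphere_four
    exact Literature.Topology.FourManifolds.pathConnectedSpace_of_homotopyEquiv e
  have hsc : SimplyConnectedSpace M :=
    Literature.Topology.FourManifolds.simplyConnectedSpace_of_homotopyEquiv_sphere_four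
      Literature.Topology.FourManifolds.simplyConnectedSpace_sphere_four_holds M e
  obtain ⟨κ, hres⟩ := hflow M e ι hι hN hsep hent
  exact helper_cylNeckSurgeryTopology (helper_immortalLeafRecognition hAF hb hmid) M κ hres hsc

/-- **Registered helper `helper_cylinderSurgeryFlowOfCylinderRungTwo` — the converse: the crux implies the surgery stub.**  Given
`CylinderRungTwo`, a homotopy sphere with a thin end-separating cross-section `ι` is `≅ S⁴`, so `ι` itself is a resolved slice (a
`discard` leaf).  Hence `stub_cylinderSurgeryFlow` is EQUIVALENT to the crux modulo {ImmortalAreaToFloor, Cor. 1.5 (b),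
certificates}: like `stub_finiteTimeHalf` before it, it is exactly as hard as the crux, and its content for `M ≅ S⁴` is nil.
[folklore] -/
theorem helper_cylinderSurgeryFlowOfCylinderRungTwo :
    Summit.SmoothPoincare4.SmoothPoincare4.Theses.CylinderEntropy.CylinderRungTwo →
    ∀ (M : Type) [TopologicalSpace M] [T2Space M] [SecondCountableTopology M]
      [ChartedSpace (EuclideanSpace ℝ (Fin 4)) M] [IsManifold (𝓡 4) ∞ M],
      M ≃ₕ Metric.sphere (0 : EuclideanSpace ℝ (Fin 5)) 1 →
      ∀ ι : M → EuclideanSpace ℝ (Fin 6), Manifold.IsSmoothEmbedding (𝓡 4) (𝓡 6) ∞ ι →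
      (∀ x, ∑ i : Fin 5, ι x (Fin.castSucc i) ^ 2 = 1) → SeparatesEnds (Set.range ι) →
      Literature.Geometry.Riemannian.SphericalCylinderEntropy.cylEntropy (Set.range ι) < ENNReal.ofReal (4 / Real.exp 1) →
      ∃ κ : M → EuclideanSpace ℝ (Fin 6), CylNeckSurgeryResolvable M κ :=
  fun hR M _ _ _ _ _ e ι hι hN hsep hent =>
    ⟨ι, CylNeckSurgeryResolvable.of_nonempty_diffeomorph_sphere (hR M e ι hι hN hsep hent) ι⟩

end Summit.SmoothPoincare4.SmoothPoincare4.Cruxes.CylinderRungTwo.KillingFlux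

end
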